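import Literature.AlgebraicGeometry.Resolution.QuadraticTransforms
import Mathlib.RingTheory.Polynomial.Basic
import Mathlib.RingTheory.Polynomial.Ideal
import Mathlib.RingTheory.Adjoin.Polynomial.Basic
import Mathlib.RingTheory.Adjoin.FG
import Mathlib.RingTheory.LocalRing.LocalSubring
import Mathlib.RingTheory.Localization.Submodule
import Mathlib.RingTheory.DiscreteValuationRing.TFAE
import Mathlib.RingTheory.Valuation.ValuationRing
import Mathlib.RingTheory.KrullDimension.PID
import HarnessLib

/-!
# The first chart of a quadratic transform: `R[y/x] ⊆ K` and its local rings

Topic: `Literature/AlgebraicGeometry/Resolution`. Support file for the discharge of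
`AbhyankarQuadraticFactorization` (`QuadraticTransforms.lean`; Abhyankar 1956, Thm. 3;
Huneke–Swanson 2006, Thm. 14.5.2). Elementary commutative algebra, entirely inside a field `K`,
phrased over Mathlib's `Algebra.adjoin R {u}` (the ring `R[u] ⊆ K` of a subring `R ⊆ K`; as a
`Subring K` it is `(Algebra.adjoin R {u}).toSubring = Subring.closure (R ∪ {u})`,
`Algebra.adjoin_eq_ring_closure`) and Mathlib's `LocalSubring.ofPrime A P` (the localisation of a
subring `A ⊆ K` at a prime `P`, inside `K`, with its `IsLocalization.AtPrime` instance):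

* `blowupRing R x = R[y/x]` when `𝔪_R = (x, y)` (`blowupRing_eq_adjoin`); `R[u]` is Noetherian
  when `R` is; the evaluation `R[X] → R[u]` (`Polynomial.aeval u`, co-restricted) is surjective.
* **Quasi-regularity of a good pair** `p, q ∈ T` (`p ≠ 0` and `p ∣ qt ⇒ p ∣ t`, e.g. a prime
  element `p ∤ q`, or relatively prime `p, q` in a UFD): a relation `Σ cᵢ qⁱ p^{N-i} = 0` forces
  all `cᵢ ∈ (p, q)` (`coeff_mem_span_pair_of_sum_eq_zero`), so a polynomial vanishing at `q/p`
  has coefficients in `(p, q)` (`coeff_mem_span_pair_of_aeval_eq_zero`); consequently for a prime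
  `𝔫 ∋ p, q` of `T` the extended ideal `𝔫 T[q/p]` is prime and contracts to `𝔫`
  (`isPrime_map_incl`, `comap_map_incl`: `T[q/p]/𝔫T[q/p] ≅ (T/𝔫)[X]`), and
  `(p, q) T[q/p] = p T[q/p]` (`map_incl_span_pair`) — the exceptional prime of the chart.
  DESIGN NOTE. The tree already has the general notion: `IsQuasiRegular` and Rees' theorem
  `isQuasiRegular_of_regularSeq` (`QuasiRegularSequences.lean`, sequences `Fin k → R`,
  homogeneous `MvPolynomial` forms, conclusion modulo `I^{ν+1}`) and the chart computation
  `(R[It])_{(x_i t)} ⧸ (x_i) ≅ (R ⧸ I)[T_j]` (`BlowupChartQuasiRegular.lean`, for the abstract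
  Rees-algebra chart). What is needed here is the two-element case *inside `K`* for a subring and
  the concrete fraction `q/p`, in the univariate form "`F(q/p) = 0 ⇒ coefficients in `(p, q)`";
  deriving it from those files means translating between homogeneous forms in
  `MvPolynomial (Fin 2)` and dehomogenised univariate polynomials and identifying the abstract
  chart with `T[q/p] ⊆ K`, which is longer than the direct forty-line induction given here, so the
  special case is proved self-containedly (same argument as Rees': the top coefficient is
  divisible by `p`).
* The local rings `A_P = LocalSubring.ofPrime A P ⊆ K`: membership (`mem_ofPrime_iff`: the
  fractions `a/s`, `s ∉ P`), `locAtCentre B O = B_{𝔪_O ∩ B}` is such a ring (`locAtCentre_eq_ofPrime`,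
  the bridge to `LocalBlowup.lean` / `IsQuadraticTransformAlong`), Noetherianity, and the two facts
  used downstream: a Noetherian local subring `T ⊆ K` with `z ∈ T ∨ z⁻¹ ∈ T` for all `z` has
  `dim T ≤ 1` (`ringKrullDim_le_one_of_forall_mem_or_inv_mem`), and the localisation of a
  Noetherian `A` (`Frac A = K`) at a principal prime `(π)` is a valuation ring of `K` whose
  non-units are multiples of `π` (`mem_or_inv_mem_ofPrime_of_span_singleton`,
  `exists_eq_mul_of_inv_not_mem_ofPrime`).

## Sources

* C. Huneke, I. Swanson, *Integral Closure of Ideals, Rings, and Modules*, CUP 2006, §14.2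
  (quadratic transformations: "`S ≅ R[t]/(xt - y)`, then `S/xS ≅ k[t]`, so that `xS = 𝔪S` is a
  prime ideal in `S`", book p. 264) and the proof of Thm. 14.5.2 (pp. 276–277). [HunekeSwanson2006]
* H. Matsumura, *Commutative Ring Theory*, CUP 1986, Thm. 16.2 (Rees). [Matsumura1987]

No new definitions; everything is [folklore]-level commutative algebra.
-/

noncomputable section

namespace Literature.AlgebraicGeometry.Resolution

universe u

open IsLocalRing Polynomial

/-! ## Quasi-regularity of a good pair -/

section QuasiRegular

variable {T : Type*} [CommRing T]

/-- If `p ∣ qt ⇒ p ∣ t` then `p ∣ qᵏt ⇒ p ∣ t`. [folklore] -/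
theorem dvd_of_dvd_pow_mul {p q : T} (hpq : ∀ t, p ∣ q * t → p ∣ t) (k : ℕ) (t : T)
    (h : p ∣ q ^ k * t) : p ∣ t := by
  induction k generalizing t with
  | zero => simpa using h
  | succ k ih =>
    have e : q ^ (k + 1) * t = q * (q ^ k * t) := by ring
    rw [e] at h
    exact ih _ (hpq _ h)

/-- **Quasi-regularity of a good pair** (the two-element case of Rees' theorem, Matsumura
Thm. 16.2; cf. `isQuasiRegular_of_regularSeq`). Let `T` be a domain and `p, q ∈ T` with `p ≠ 0`
and `p ∣ qt ⇒ p ∣ t` (so `p, q` is a `T`-regular sequence). If `Σ_{i ≤ N} cᵢ qⁱ p^{N-i} = 0` then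
every `cᵢ ∈ (p, q)`: the top coefficient is divisible by `p`, which lowers the degree.
[cite: Matsumura1987, Thm. 16.2] -/
theorem coeff_mem_span_pair_of_sum_eq_zero [IsDomain T] {p q : T} (hp0 : p ≠ 0)
    (hpq : ∀ t, p ∣ q * t → p ∣ t) (N : ℕ) (c : ℕ → T)
    (h : ∑ i ∈ Finset.range (N + 1), c i * q ^ i * p ^ (N - i) = 0) :
    ∀ i ≤ N, c i ∈ Ideal.span {p, q} := by
  induction N generalizing c with
  | zero =>
    intro i hi
    obtain rfl : i = 0 := Nat.le_zero.mp hi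
    have h0 : c 0 = 0 := by simpa using h
    rw [h0]; exact zero_mem _
  | succ N ih =>
    rw [Finset.sum_range_succ] at h
    have hS : ∑ i ∈ Finset.range (N + 1), c i * q ^ i * p ^ (N + 1 - i) =
        p * ∑ i ∈ Finset.range (N + 1), c i * q ^ i * p ^ (N - i) := by
      rw [Finset.mul_sum]
      refine Finset.sum_congr rfl fun i hi => ?_
      have hi' : i ≤ N := Nat.lt_succ_iff.mp (Finset.mem_range.mp hi)
      have e : N + 1 - i = N - i + 1 := by omega
      rw [e, pow_succ]; ring
    rw [hS, Nat.sub_self, pow_zero, mul_one] at h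
    set S := ∑ i ∈ Finset.range (N + 1), c i * q ^ i * p ^ (N - i) with hSdef
    have hdvd : p ∣ c (N + 1) := by
      refine dvd_of_dvd_pow_mul hpq (N + 1) _ ⟨-S, ?_⟩
      linear_combination h
    obtain ⟨c', hc'⟩ := hdvd
    have h2 : S + c' * q ^ (N + 1) = 0 := by
      have : p * (S + c' * q ^ (N + 1)) = 0 := by
        rw [hc'] at h; linear_combination h
      exact (mul_eq_zero.mp this).resolve_left hp0
    let c'' : ℕ → T := fun i => if i = N then c N + c' * q else c i
    have h3 : ∑ i ∈ Finset.range (N + 1), c'' i * q ^ i * p ^ (N - i) = 0 := by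
      rw [Finset.sum_range_succ]
      rw [hSdef, Finset.sum_range_succ] at h2
      have e1 : ∑ i ∈ Finset.range N, c'' i * q ^ i * p ^ (N - i) =
          ∑ i ∈ Finset.range N, c i * q ^ i * p ^ (N - i) := by
        refine Finset.sum_congr rfl fun i hi => ?_
        have : i ≠ N := (Finset.mem_range.mp hi).ne
        simp [c'', this]
      rw [e1]
      simp only [c'', if_pos rfl, Nat.sub_self, pow_zero, mul_one] at h2 ⊢
      linear_combination h2
    have ih' := ih c'' h3
    intro i hi
    by_cases hlt : i < N
    · have := ih' i hlt.le
      simp only [c'', if_neg hlt.ne] at this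
      exact this
    by_cases heq : i = N
    · subst heq
      have := ih' i le_rfl
      simp only [c'', if_pos rfl] at this
      have e : c i = (c i + c' * q) - c' * q := by ring
      rw [e]
      exact Ideal.sub_mem _ this (Ideal.mul_mem_left _ _ (Ideal.subset_span (by simp)))
    · obtain rfl : i = N + 1 := by omega
      rw [hc']
      exact Ideal.mul_mem_right _ _ (Ideal.subset_span (by simp))

end QuasiRegular

variable {K : Type u} [Field K]

/-- The field form of quasi-regularity: for a good pair `p, q` in a subring `T ⊆ K`, a polynomial
`F ∈ T[X]` with `F(q/p) = 0` has all its coefficients in `(p, q)` (multiply by `p^{deg F}`).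
[folklore] -/
theorem coeff_mem_span_pair_of_aeval_eq_zero {T : Subring K} {p q : T} (hp0 : p ≠ 0)
    (hpq : ∀ t, p ∣ q * t → p ∣ t) {F : T[X]} (hF : aeval ((q : K) / p) F = 0) (i : ℕ) :
    F.coeff i ∈ Ideal.span {p, q} := by
  set N := F.natDegree with hN
  by_cases hi : i ≤ N
  swap
  · rw [Polynomial.coeff_eq_zero_of_natDegree_lt (not_le.mp hi)]; exact zero_mem _
  refine coeff_mem_span_pair_of_sum_eq_zero hp0 hpq N (fun i => F.coeff i) ?_ i hi
  have hp0' : ((p : T) : K) ≠ 0 := fun e => hp0 (Subtype.ext e)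
  rw [aeval_eq_sum_range] at hF
  have key : ∀ j ∈ Finset.range (N + 1),
      (p : K) ^ N * (F.coeff j • ((q : K) / p) ^ j) =
        ((F.coeff j : T) : K) * (q : K) ^ j * (p : K) ^ (N - j) := by
    intro j hj
    have hj' : j ≤ N := Nat.lt_succ_iff.mp (Finset.mem_range.mp hj)
    rw [Algebra.smul_def, Algebra.algebraMap_ofSubsemiring_apply, div_pow,
      ← pow_sub_mul_pow (p : K) hj']
    field_simp
  apply Subtype.val_injective
  push_cast
  rw [← Finset.sum_congr rfl key, ← Finset.mul_sum, hF, mul_zero]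

/-! ## `R[u] = Algebra.adjoin R {u} ⊆ K` for a subring `R ⊆ K` -/

section Adjoin

variable (R : Subring K) (u : K)

/-- `R ⊆ R[u]` as subrings of `K`. [folklore] -/
theorem subring_le_adjoin : R ≤ (Algebra.adjoin R {u}).toSubring :=
  fun r hr => (Algebra.adjoin R {u}).algebraMap_mem ⟨r, hr⟩

variable {R u}

/-- An element of `R[u]` is the value at `u` of a polynomial over `R` (Mathlib's
`Algebra.adjoin_mem_exists_aeval`, for membership in the `Subring`). [folklore] -/
theorem exists_aeval_eq_of_mem_adjoin {z : K} (hz : z ∈ (Algebra.adjoin R {u}).toSubring) :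
    ∃ F : R[X], aeval u F = z :=
  Algebra.adjoin_mem_exists_aeval R u hz

/-- `R[u]` lies in every subring of `K` containing `R` and `u`. [folklore] -/
theorem adjoin_toSubring_le {S : Subring K} (h : R ≤ S) (hu : u ∈ S) :
    (Algebra.adjoin R {u}).toSubring ≤ S := by
  intro z hz
  obtain ⟨F, rfl⟩ := exists_aeval_eq_of_mem_adjoin hz
  rw [aeval_eq_sum_range]
  refine sum_mem fun i _ => ?_
  rw [Algebra.smul_def, Algebra.algebraMap_ofSubsemiring_apply]
  exact S.mul_mem (h (F.coeff i).2) (S.pow_mem hu i)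

/-- **The chart `x ≠ 0` of the blowing up of `𝔪_R = (x, y)` is `R[y/x]`**:
`blowupRing R x = R[y/x]` (for `x = 0` both sides are `R`, with `y/0 = 0`).
[cite: HunekeSwanson2006, §14.2 (p. 264)] -/
theorem blowupRing_eq_adjoin {R : Subring K} [IsLocalRing R] {x y : R}
    (hxy : maximalIdeal R = Ideal.span {x, y}) :
    blowupRing R (x : K) = (Algebra.adjoin R {((y : R) : K) / x}).toSubring := by
  have hxx : ((x : R) : K) / x ∈ R := by
    by_cases h0 : ((x : R) : K) = 0
    · rw [h0, div_zero]; exact R.zero_mem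
    · rw [div_self h0]; exact R.one_mem
  rw [blowupRing_eq_closure_of_span_eq (x : K) ({x, y} : Set R) hxy.symm,
    Algebra.adjoin_eq_ring_closure, Set.image_insert_eq, Set.image_singleton]
  have hrange : Set.range (algebraMap R K) = (R : Set K) := by
    ext z
    constructor
    · rintro ⟨r, rfl⟩; exact r.2
    · intro hz; exact ⟨⟨z, hz⟩, rfl⟩
  rw [hrange]
  apply le_antisymm
  · refine Subring.closure_le.mpr ?_
    rintro z (hz | hz | hz)
    · exact Subring.subset_closure (Or.inl hz)
    · rw [hz]; exact Subring.subset_closure (Or.inl hxx)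
    · exact Subring.subset_closure (Or.inr hz)
  · exact Subring.closure_mono (Set.union_subset_union_right _ (Set.subset_insert _ _))

/-- `R[u]` is Noetherian when `R` is (Hilbert's basis theorem, `isNoetherianRing_of_fg`).
[folklore] -/
theorem isNoetherianRing_adjoin_toSubring (R : Subring K) [IsNoetherianRing R] (u : K) :
    IsNoetherianRing (Algebra.adjoin R {u}).toSubring := by
  have hfg : (Algebra.adjoin R ({u} : Set K)).FG := by
    rw [← Finset.coe_singleton]
    exact Subalgebra.fg_adjoin_finset {u}
  exact isNoetherianRing_of_fg hfg

/-- The evaluation `R[X] → R[u]`, `F ↦ F(u)` (`Polynomial.aeval u` co-restricted to `R[u]`), is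
surjective. [folklore] -/
theorem aevalCod_surjective (R : Subring K) (u : K)
    (h : ∀ F : R[X], (aeval u).toRingHom F ∈ (Algebra.adjoin R {u}).toSubring) :
    Function.Surjective ((aeval u).toRingHom.codRestrict (Algebra.adjoin R {u}).toSubring h) :=
  fun z => (exists_aeval_eq_of_mem_adjoin z.2).imp fun _ hF => Subtype.ext hF

/-- Extension of an ideal `𝔫` of `R` to `R[u]` is the image of `𝔫 R[X]` under evaluation.
[folklore] -/
theorem map_map_aevalCod (n : Ideal R) (u : K)
    (h : ∀ F : R[X], (aeval u).toRingHom F ∈ (Algebra.adjoin R {u}).toSubring) :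
    (n.map C).map ((aeval u).toRingHom.codRestrict (Algebra.adjoin R {u}).toSubring h) =
      n.map (Subring.inclusion (subring_le_adjoin R u)) := by
  rw [Ideal.map_map]
  congr 1
  ext r
  change aeval u (C r) = (r : K)
  rw [aeval_C]
  rfl

/-- A polynomial with coefficients in `𝔫` evaluates into the extended ideal `𝔫 R[u]` (one half
of Mathlib's `Algebra.mem_ideal_map_adjoin`, in the `Subring.inclusion` form of this topic).
[folklore] -/
theorem aeval_mem_map_incl_of_coeff_mem {n : Ideal R} {u : K} {G : R[X]}
    (hG : ∀ i, G.coeff i ∈ n) :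
    (⟨aeval u G, Polynomial.aeval_mem_adjoin_singleton R u⟩ : (Algebra.adjoin R {u}).toSubring) ∈
      n.map (Subring.inclusion (subring_le_adjoin R u)) :=
  (Algebra.mem_ideal_map_adjoin u n).mpr ⟨G, hG, rfl⟩

/-- An element of the extended ideal `𝔫 R[u]` is the value of a polynomial with coefficients in
`𝔫` (the other half of Mathlib's `Algebra.mem_ideal_map_adjoin`). [folklore] -/
theorem exists_aeval_eq_of_mem_map_incl {n : Ideal R} {u : K}
    {z : (Algebra.adjoin R {u}).toSubring}
    (hz : z ∈ n.map (Subring.inclusion (subring_le_adjoin R u))) :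
    ∃ F : R[X], (∀ i, F.coeff i ∈ n) ∧ aeval u F = (z : K) :=
  (Algebra.mem_ideal_map_adjoin u n).mp hz

end Adjoin

/-! ## The chart of a good pair: the exceptional prime -/

section Chart

variable {T : Subring K} {p q : T}

/-- **The kernel of `T[X] → T[q/p]` lies in `(p, q) T[X]`** for a good pair `p, q`
(`p ≠ 0`, `p ∣ qt ⇒ p ∣ t`). [folklore] -/
theorem ker_aevalCod_le (hp0 : p ≠ 0) (hpq : ∀ t, p ∣ q * t → p ∣ t)
    (h : ∀ F : T[X], (aeval ((q : K) / p)).toRingHom F ∈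
      (Algebra.adjoin T {((q : T) : K) / p}).toSubring) :
    RingHom.ker ((aeval ((q : K) / p)).toRingHom.codRestrict _ h) ≤ (Ideal.span {p, q}).map C := by
  intro F hF
  rw [Ideal.mem_map_C_iff]
  rw [RingHom.mem_ker, Subtype.ext_iff] at hF
  exact coeff_mem_span_pair_of_aeval_eq_zero hp0 hpq hF

/-- `(p, q) ⊆ 𝔫` as an inequality of ideals. [folklore] -/
theorem span_pair_le_of_mem {n : Ideal T} (hpn : p ∈ n) (hqn : q ∈ n) :
    Ideal.span {p, q} ≤ n := by
  rw [Ideal.span_le]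
  rintro _ (rfl | rfl)
  exacts [hpn, hqn]

/-- **The extension to `T[q/p]` of a prime `𝔫 ∋ p, q` of `T` is prime** (good pair `p, q`):
`T[q/p]/𝔫T[q/p] ≅ (T/𝔫)[X]` (Huneke–Swanson p. 264: "`S/xS ≅ k[t]`, so that `xS = 𝔪S` is a
prime ideal"). [cite: HunekeSwanson2006, §14.2 (p. 264)] -/
theorem isPrime_map_incl (hp0 : p ≠ 0) (hpq : ∀ t, p ∣ q * t → p ∣ t) {n : Ideal T}
    [n.IsPrime] (hpn : p ∈ n) (hqn : q ∈ n) :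
    (n.map (Subring.inclusion (subring_le_adjoin T (((q : T) : K) / p)))).IsPrime := by
  rw [← map_map_aevalCod n _ (fun _ => Polynomial.aeval_mem_adjoin_singleton T _)]
  haveI : (n.map (C : T →+* T[X])).IsPrime := Ideal.isPrime_map_C_of_isPrime
  exact Ideal.map_isPrime_of_surjective (aevalCod_surjective T _ _)
    ((ker_aevalCod_le hp0 hpq _).trans (Ideal.map_mono (span_pair_le_of_mem hpn hqn)))

/-- **The extension of an ideal `𝔫 ∋ p, q` of `T` to `T[q/p]` contracts to `𝔫`** (good pair
`p, q`). [folklore] -/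
theorem comap_map_incl (hp0 : p ≠ 0) (hpq : ∀ t, p ∣ q * t → p ∣ t) {n : Ideal T}
    (hpn : p ∈ n) (hqn : q ∈ n) :
    (n.map (Subring.inclusion (subring_le_adjoin T (((q : T) : K) / p)))).comap
      (Subring.inclusion (subring_le_adjoin T (((q : T) : K) / p))) = n := by
  refine le_antisymm ?_ Ideal.le_comap_map
  intro t ht
  rw [Ideal.mem_comap] at ht
  obtain ⟨F, hF, hFt⟩ := exists_aeval_eq_of_mem_map_incl ht
  have hzero : aeval (((q : T) : K) / p) (F - C t) = 0 := by
    rw [map_sub, hFt, aeval_C]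
    exact sub_self _
  have h0 := span_pair_le_of_mem hpn hqn (coeff_mem_span_pair_of_aeval_eq_zero hp0 hpq hzero 0)
  rw [coeff_sub, coeff_C_zero] at h0
  simpa using n.sub_mem (hF 0) h0

/-- For `t ∈ T`: `t ∈ 𝔫 T[q/p] ↔ t ∈ 𝔫` (good pair `p, q ∈ 𝔫`). [folklore] -/
theorem incl_mem_map_incl_iff (hp0 : p ≠ 0) (hpq : ∀ t, p ∣ q * t → p ∣ t) {n : Ideal T}
    (hpn : p ∈ n) (hqn : q ∈ n) (t : T) :
    Subring.inclusion (subring_le_adjoin T (((q : T) : K) / p)) t ∈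
      n.map (Subring.inclusion (subring_le_adjoin T (((q : T) : K) / p))) ↔ t ∈ n := by
  conv_rhs => rw [← comap_map_incl hp0 hpq hpn hqn]
  rw [Ideal.mem_comap]

/-- **The exceptional ideal**: `(p, q) T[q/p] = p T[q/p]`, as `q = p · (q/p)`. [folklore] -/
theorem map_incl_span_pair (hp0 : p ≠ 0) (q : T) :
    (Ideal.span {p, q}).map (Subring.inclusion (subring_le_adjoin T (((q : T) : K) / p))) =
      Ideal.span {Subring.inclusion (subring_le_adjoin T (((q : T) : K) / p)) p} := by
  have hp0' : ((p : T) : K) ≠ 0 := fun e => hp0 (Subtype.ext e)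
  rw [Ideal.map_span, Set.image_insert_eq, Set.image_singleton]
  apply le_antisymm
  · rw [Ideal.span_le]
    rintro _ (rfl | rfl)
    · exact Ideal.subset_span rfl
    · rw [SetLike.mem_coe, Ideal.mem_span_singleton]
      refine ⟨⟨(q : K) / p, Algebra.self_mem_adjoin_singleton T _⟩, Subtype.ext ?_⟩
      change ((q : T) : K) = (p : K) * ((q : K) / p)
      field_simp
  · exact Ideal.span_mono (Set.singleton_subset_iff.mpr (Set.mem_insert _ _))

end Chart

/-! ## The local rings `A_P = LocalSubring.ofPrime A P ⊆ K` -/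

section OfPrime

variable {A : Subring K} {P : Ideal A} [hP : P.IsPrime]

omit hP in
/-- An element outside an ideal is non-zero in `K`. [folklore] -/
theorem coe_ne_zero_of_not_mem {s : A} (hs : s ∉ P) : ((s : A) : K) ≠ 0 := by
  intro h
  apply hs
  rw [show s = 0 from Subtype.ext h]
  exact P.zero_mem

/-- **Membership in `A_P = LocalSubring.ofPrime A P ⊆ K`**: the fractions `a/s` with `a ∈ A`,
`s ∈ A ∖ P` (read off the `IsLocalization.AtPrime` instance of `LocalSubring.ofPrime`).
[folklore] -/
theorem mem_ofPrime_iff {z : K} :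
    z ∈ (LocalSubring.ofPrime A P).toSubring ↔ ∃ a s : A, s ∉ P ∧ z = a / s := by
  constructor
  · intro hz
    obtain ⟨⟨a, s⟩, h⟩ := IsLocalization.mk'_surjective P.primeCompl
      (⟨z, hz⟩ : (LocalSubring.ofPrime A P).toSubring)
    dsimp only at h
    refine ⟨a, s, s.2, ?_⟩
    have hspec := IsLocalization.mk'_spec (LocalSubring.ofPrime A P).toSubring a s
    rw [h] at hspec
    have e := congrArg (fun t : (LocalSubring.ofPrime A P).toSubring => (t : K)) hspec
    change z * ((s : A) : K) = (a : K) at e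
    rw [← e, mul_div_cancel_right₀ _ (coe_ne_zero_of_not_mem s.2)]
  · rintro ⟨a, s, hs, rfl⟩
    set w := IsLocalization.mk' (LocalSubring.ofPrime A P).toSubring a
      (⟨s, hs⟩ : P.primeCompl) with hw
    have hspec := IsLocalization.mk'_spec (LocalSubring.ofPrime A P).toSubring a
      (⟨s, hs⟩ : P.primeCompl)
    have e := congrArg (fun t : (LocalSubring.ofPrime A P).toSubring => (t : K)) hspec
    change (w : K) * ((s : A) : K) = (a : K) at e
    rw [← e, mul_div_cancel_right₀ _ (coe_ne_zero_of_not_mem hs)]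
    exact w.2

/-- `a/s ∈ A_P` for `s ∉ P`. [folklore] -/
theorem div_mem_ofPrime (a : A) {s : A} (hs : s ∉ P) :
    (a : K) / s ∈ (LocalSubring.ofPrime A P).toSubring :=
  mem_ofPrime_iff.mpr ⟨a, s, hs, rfl⟩

/-- `s⁻¹ ∈ A_P` for `s ∉ P`. [folklore] -/
theorem inv_mem_ofPrime {s : A} (hs : s ∉ P) :
    ((s : A) : K)⁻¹ ∈ (LocalSubring.ofPrime A P).toSubring :=
  mem_ofPrime_iff.mpr ⟨1, s, hs, by simp⟩

/-- `A_P ⊆ T` as soon as `A ⊆ T` and the elements of `A ∖ P` are invertible in `T`. [folklore] -/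
theorem ofPrime_le {T : Subring K} (hAT : A ≤ T) (h : ∀ s : A, s ∉ P → ((s : A) : K)⁻¹ ∈ T) :
    (LocalSubring.ofPrime A P).toSubring ≤ T := by
  intro z hz
  obtain ⟨a, s, hs, rfl⟩ := mem_ofPrime_iff.mp hz
  rw [div_eq_mul_inv]
  exact T.mul_mem (hAT a.2) (h s hs)

/-- **The local ring at the centre of a valuation ring is such a localisation**:
`locAtCentre B O = B_{𝔪_O ∩ B} = LocalSubring.ofPrime B (subringCentre B O h)` for `B ⊆ O` —
the bridge between `LocalBlowup.lean` (`IsQuadraticTransformAlong`, `locAtCentre`) and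
`LocalSubring.ofPrime`. [cite: NovacoskiSpivakovsky2014, Def. 2.8] -/
theorem locAtCentre_eq_ofPrime {B : Subring K} {O : ValuationSubring K} (h : B ≤ O.toSubring) :
    locAtCentre B O = (LocalSubring.ofPrime B (subringCentre B O h)).toSubring := by
  ext z
  rw [mem_locAtCentre_iff, mem_ofPrime_iff]
  constructor
  · rintro ⟨y, hy, w, hw, hv, rfl⟩
    refine ⟨⟨y, hy⟩, ⟨w, hw⟩, fun hc => ?_, rfl⟩
    rw [mem_subringCentre_iff] at hc
    exact (lt_irrefl _) (hv ▸ hc)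
  · rintro ⟨a, s, hs, rfl⟩
    exact ⟨a, a.2, s, s.2, valuation_eq_one_of_not_mem_subringCentre h hs, rfl⟩

/-- `A_P` is Noetherian when `A` is. [folklore] -/
theorem isNoetherianRing_ofPrime [IsNoetherianRing A] :
    IsNoetherianRing (LocalSubring.ofPrime A P).toSubring :=
  IsLocalization.isNoetherianRing P.primeCompl _ ‹_›

/-- If every element of `K` is a quotient of elements of `A` then `K` is the fraction field of
`A_P`. [folklore] -/
theorem isFractionRing_ofPrime (hK : ∀ z : K, ∃ a ∈ A, ∃ b ∈ A, b ≠ 0 ∧ z = a / b) :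
    IsFractionRing (LocalSubring.ofPrime A P).toSubring K := by
  refine IsFractionRing.of_field (R := (LocalSubring.ofPrime A P).toSubring) (K := K)
    (surj := fun z => ?_)
  obtain ⟨a, ha, b, hb, -, rfl⟩ := hK z
  exact ⟨⟨a, LocalSubring.le_ofPrime A P ha⟩, ⟨b, LocalSubring.le_ofPrime A P hb⟩, rfl⟩

end OfPrime

/-! ## Valuation rings: dimension, and the local ring at a principal prime -/

/-- **A Noetherian local subring `T ⊆ K` which is a valuation ring of `K` (`z ∈ T` or
`z⁻¹ ∈ T` for every `z ∈ K`) has dimension `≤ 1`** (it is a principal ideal ring).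
[folklore] -/
theorem ringKrullDim_le_one_of_forall_mem_or_inv_mem {T : Subring K} [IsNoetherianRing T]
    [IsLocalRing T] (h : ∀ z : K, z ∈ T ∨ z⁻¹ ∈ T) : ringKrullDim T ≤ 1 := by
  haveI : ValuationRing T := by
    refine { cond' := fun a b => ?_ }
    rcases h ((a : K) / b) with hz | hz
    · by_cases hb : (b : K) = 0
      · exact ⟨0, Or.inl (Subtype.ext (by simp [hb]))⟩
      · refine ⟨⟨_, hz⟩, Or.inr (Subtype.ext ?_)⟩
        change (b : K) * (a / b) = a
        field_simp
    · by_cases ha : (a : K) = 0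
      · exact ⟨0, Or.inr (Subtype.ext (by simp [ha]))⟩
      · refine ⟨⟨_, hz⟩, Or.inl (Subtype.ext ?_)⟩
        change (a : K) * ((a : K) / b)⁻¹ = b
        by_cases hb : (b : K) = 0
        · simp [hb]
        · field_simp
  haveI : IsPrincipalIdealRing T :=
    ((tfae_of_isNoetherianRing_of_isLocalRing_of_isDomain T).out 0 1).mpr ‹_›
  rw [← Nat.cast_one, ← Ring.krullDimLE_iff]
  infer_instance

section PrincipalPrime

variable {A : Subring K}

/-- **The local ring of a Noetherian `A ⊆ K = Frac A` at a principal prime `(π)` is a valuation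
ring of `K`**: a Noetherian local domain with principal maximal ideal. [folklore] -/
theorem mem_or_inv_mem_ofPrime_of_span_singleton [IsNoetherianRing A] {P : Ideal A} [P.IsPrime]
    {π : A} (hPπ : P = Ideal.span {π}) (hK : ∀ z : K, ∃ a ∈ A, ∃ b ∈ A, b ≠ 0 ∧ z = a / b)
    (z : K) :
    z ∈ (LocalSubring.ofPrime A P).toSubring ∨ z⁻¹ ∈ (LocalSubring.ofPrime A P).toSubring := by
  subst hPπ
  set V := (LocalSubring.ofPrime A (Ideal.span {π})).toSubring with hV
  haveI := isFractionRing_ofPrime (P := Ideal.span {π}) hK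
  haveI := isNoetherianRing_ofPrime (A := A) (P := Ideal.span {π})
  have hprinc : (maximalIdeal V).IsPrincipal := by
    rw [← IsLocalization.AtPrime.map_eq_maximalIdeal (Ideal.span {π}) V, Ideal.map_span,
      Set.image_singleton]
    exact ⟨algebraMap A _ π, rfl⟩
  haveI : ValuationRing V :=
    ((tfae_of_isNoetherianRing_of_isLocalRing_of_isDomain V).out 1 4).mpr hprinc
  rcases ValuationRing.isInteger_or_isInteger V z with ⟨w, hw⟩ | ⟨w, hw⟩
  · exact Or.inl (hw ▸ w.2)
  · exact Or.inr (hw ▸ w.2)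

/-- In the local ring at a principal prime `(π)`, an element whose inverse is not in the ring is a
multiple of `π`. [folklore] -/
theorem exists_eq_mul_of_inv_not_mem_ofPrime {P : Ideal A} [P.IsPrime] {π : A}
    (hPπ : P = Ideal.span {π}) {z : K} (hz : z ∈ (LocalSubring.ofPrime A P).toSubring)
    (hzi : z⁻¹ ∉ (LocalSubring.ofPrime A P).toSubring) :
    ∃ w ∈ (LocalSubring.ofPrime A P).toSubring, z = (π : K) * w := by
  subst hPπ
  set V := (LocalSubring.ofPrime A (Ideal.span {π})).toSubring with hV
  have hm : (⟨z, hz⟩ : V) ∈ maximalIdeal V :=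
    (mem_maximalIdeal_iff_inv_not_mem _).mpr (Or.inr hzi)
  rw [← IsLocalization.AtPrime.map_eq_maximalIdeal (Ideal.span {π}) V, Ideal.map_span,
    Set.image_singleton, Ideal.mem_span_singleton'] at hm
  obtain ⟨w, hw⟩ := hm
  refine ⟨w, w.2, ?_⟩
  have e := congrArg (fun t : V => (t : K)) hw
  change (w : K) * (π : K) = z at e
  rw [← e, mul_comm]

end PrincipalPrime

end Literature.AlgebraicGeometry.Resolution

end
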